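import Literature.NumberTheory.EllipticCurves.BSDSelmerCMPConverseCMFieldTwistFamily
import Literature.NumberTheory.EllipticCurves.IsogenyTwoPowerQuotientProofs
import Literature.NumberTheory.EllipticCurves.KummerSelmerGroupFinite
import Mathlib.RingTheory.Ideal.Norm.AbsNorm
import HarnessLib

/-!
# Burungale–Tian 2026, "Proof of Proposition 1.3" replayed in the kernel — proofs only

A `…Proofs` companion (theorems only: no definition, no named fact, no instance) of
`BSDSelmerCMPConverseCMFieldTwistFamily` (A. A. Burungale, Y. Tian, *A rank zero `p`-converse to a
theorem of Gross–Zagier, Kolyvagin and Rubin*, Ann. of Math. (2) **203** (2026), no. 1, 1–13 =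
arXiv:2506.03465v2), which vendored the two printed statements about the quadratic twist family
`E^{(t)}`, `t ∈ K^×/(K^×)²`, of a CM elliptic curve over its CM field `K` as named facts:

* `burungaleTian_thm35_selmerCorank_three_twists` — Thm. 3.5 (= Bhargava–Klagsbrun–Lemke
  Oliver–Shnidman, Duke Math. J. 168 (2019), Thm. 2.7 with §9.2): for at least `50%` of
  `t ∈ K^×/(K^×)²`, `corank_{ℤ₃} Sel_{3^∞}(E^{(t)}/K) = 0`;
* `burungaleTian_prop13_analyticRank_twists` — Prop. 1.3: for at least `50%` of `t ∈ K^×/(K^×)²`,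
  `ord_{s=1} L(s, E^{(t)}/K) = 0`,

and recorded (module docstring there) that the printed proof of Prop. 1.3,

> "*Proof of Proposition 1.3.* This is a consequence of Theorem 3.5 and the `3`-converse
> Theorem 1.1." (arXiv p. 7, §3.2.2),

was **not** replayed in the kernel for want of two elementary inputs: (a) that each twist `E^{(t)}`
again has complex multiplication by an order of `K` *defined over `K`* (so that Thm. 1.1,
`burungaleTian_analyticRank_eq_zero_of_selmerCorank_eq_zero_of_hasRationalCM`, applies to it), and
(b) that there are only finitely many square classes of bounded height (so that the two counting
functions of `SquareClassProportionGe` can be compared). This file supplies both and proves the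
implication **Thm. 3.5 ∧ Thm. 1.1 ⟹ Prop. 1.3** exactly as printed:

* `WeierstrassCurve.hasRationalCM_iff_exists_isogeny` (`HasRationalCM.exists_isogeny`,
  `hasRationalCM_of_isogeny`) — `End_K(E) ⊋ ℤ` iff some isogeny `φ : E → E` over `K` (a term of the
  tree's `Isogeny E E`) is no `[n]`, i.e. for every `n` moves some `P ∈ E(K̄)` off `nP` (Silverman
  *AEC* III.4: `End_K(E)` consists of the isogenies `E → E` defined over `K` and `[0]`; tree
  `mem_geomEndRing_iff_holds`).
* `WeierstrassCurve.HasRationalCM.smul`, `…of_smul`, `hasRationalCM_smul_iff` — **`End_K(E) ⊋ ℤ` is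
  invariant under `K`-isomorphisms** `E ≅ C • E` (conjugate `φ` by the isogenies of the change of
  variables and of its inverse, tree `VariableChange.toIsogeny`,
  `VariableChange.cast_toIsogeny_inv_toIsogeny`; Silverman *AEC* III.3.1(b)).
* `WeierstrassCurve.HasRationalCM.quadraticTwist` — **(a): `End_K(E^{(d)}) ⊋ ℤ` whenever
  `End_K(E) ⊋ ℤ`** (`char K = 0`, `d ∈ K^×`): the twist `φ^{(d)} = ι⁻¹ ∘ φ ∘ ι` of a `K`-rational
  endomorphism `φ ∉ ℤ` by the `K(√d)`-isomorphism `ι : E^{(d)} ≅ E` is again defined over `K`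
  (tree `Isogeny.quadraticTwist`, Cremona *Algorithms* §3.9: the two cocycles `σ ↦ ±1` cancel) and
  is no `[n]` (else `φ = ι ∘ [n] ∘ ι⁻¹ = [n]`). This is the classical fact that the endomorphisms
  of a CM curve over a field containing the CM field stay rational on all its twists (Silverman,
  *Advanced Topics*, II Thm. 2.2 (b): every endomorphism is defined over `K · K = K`).
* `hasFiniteMulSupport_squareClassHeight`, `absNorm_le_squareClassHeight_of_ne_one`,
  `finite_setOf_squareClassHeight_lt` — **(b): `{t ∈ K^×/(K^×)² : H(t) < X}` is finite**: a class
  of height `< X` has even valuation at every prime of norm `≥ X`, so lies in the Selmer group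
  `K(S_X, 2)`, `S_X = {𝔭 : N𝔭 < X}` (finite, Mathlib `Ideal.finite_setOf_absNorm_le`), which is
  finite (tree `NumberField.finite_selmerGroup`: Dirichlet units + finiteness of the class group;
  Bhargava–Klagsbrun–Lemke Oliver–Shnidman 2019, §2: "`Σ(X) := {s ∈ Σ : H(s) < X}`", a finite set).
* `SquareClassProportionGe.mono` — "at least `δ` of `t` satisfy `P`" and `P ⊆ Q` give "at least
  `δ` of `t` satisfy `Q`" (monotonicity of `liminf`, both ratios in `[0, 1]`).
* `squareClassProportionGe_analyticRank_of_selmerCorank` — for `K` imaginary quadratic and `E/K`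
  with `End_K(E) ⊋ ℤ`, Thm. 1.1 at a prime `p` turns "at least `δ` of the `E^{(t)}` have
  `corank Sel_{p^∞} = 0`" into "at least `δ` of the `E^{(t)}` have `ord_{s=1} L = 0`".
* `burungaleTian_prop13_of_thm35_of_thm11` — **the printed proof**:
  `burungaleTian_thm35_selmerCorank_three_twists →
   burungaleTian_analyticRank_eq_zero_of_selmerCorank_eq_zero_of_hasRationalCM →
   burungaleTian_prop13_analyticRank_twists`.

So the named fact `burungaleTian_prop13_analyticRank_twists` is now DERIVED in the kernel from
Thm. 3.5 (BKLOS 2019 Thm. 2.7/§9.2, refereed) and Thm. 1.1 (Annals 2026, refereed); an audit may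
price it as those two inputs. Nothing printed is restated; no statement of the vendored facts is
changed.

## References

* [BurungaleTian2026] A. A. Burungale, Y. Tian, Ann. of Math. (2) 203 (2026), no. 1, 1–13 =
  arXiv:2506.03465v2: Prop. 1.3 (p. 2), Thm. 1.1 (p. 1), §3.2.2 Thm. 3.5 and "Proof of
  Proposition 1.3" (p. 7).
* [BhargavaKlagsbrunLemkeOliverShnidman2019] Duke Math. J. 168 (2019), no. 15, 2951–2989 =
  arXiv:1709.09790: §2 (`H(s)`, `Σ(X)`), Thm. 2.7, §9.2.
* [SilvermanAEC2009] J. H. Silverman, *The Arithmetic of Elliptic Curves*, 2nd ed.: III.3.1(b),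
  III.4, X.2 Prop. 2.4, X.5 Cor. 5.4.
* [SilvermanATAEC1994] J. H. Silverman, *Advanced Topics*, II §2 Thm. 2.2 (b).
* [CremonaAlgorithms1997] J. E. Cremona, *Algorithms for Modular Elliptic Curves*, §3.9 (p. 87).
-/

noncomputable section

open scoped Classical
open Filter Topology

universe u

/-! ## (a) `End_K(E) ⊋ ℤ` survives `K`-isomorphisms and quadratic twists -/

namespace WeierstrassCurve

variable {K : Type u} [Field K]

/-- **`End_K(E) ⊋ ℤ` supplies a `K`-isogeny `E → E` which is no `[n]`.** An element of
`End_K(E) = End_{K̄}(E) ∩ (Γ_K-equivariant)` which is not an integer is nonzero, hence algebraic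
(`mem_geomEndRing_iff_holds`: `End_{K̄}(E)` is `[0]` together with the algebraic endomorphisms),
`Γ_K`-equivariant and with finite kernel — an isogeny over `K` — and for each `n ∈ ℤ` it moves some
point `P ∈ E(K̄)` off `nP`. Silverman, *AEC*, III.4 (`End(E)`; an isogeny defined over `K`).
[cite: SilvermanAEC2009, III.4 (Definition of Hom(E₁,E₂), End(E)) and Remark 4.3] -/
theorem HasRationalCM.exists_isogeny {V : WeierstrassCurve K} [V.IsElliptic] (h : V.HasRationalCM) :
    ∃ φ : Isogeny V V, ∀ n : ℤ, ∃ P : V.geomPoints, φ P ≠ n • P := by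
  obtain ⟨φ, hφ, hne⟩ := h
  set φ' : V.geomPoints →+ V.geomPoints := φ with hφ'def
  have hφ0 : φ' ≠ 0 := fun h0 ↦ hne 0 (by rw [Int.cast_zero]; exact h0)
  have halg : IsAlgebraicOn V V φ' :=
    ((V.mem_geomEndRing_iff_holds φ).1 (Subring.mem_inf.1 hφ).1).resolve_left hφ0
  have hequiv := (V.mem_equivariantSubring_iff φ).1 (Subring.mem_inf.1 hφ).2
  refine ⟨⟨φ', halg, fun σ P ↦ hequiv σ P, halg.finite_ker⟩, fun n ↦ ?_⟩
  by_contra hall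
  simp only [not_exists, not_not] at hall
  apply hne n
  refine DFunLike.ext _ _ fun P ↦ ?_
  rw [AddMonoid.End.intCast_apply]
  exact hall P

/-- **A `K`-isogeny `E → E` which is no `[n]` witnesses `End_K(E) ⊋ ℤ`**: it lies in `End_K(E)`
(`Isogeny.toAddMonoidHom_mem_endRing`). Silverman, *AEC*, III.4. [cite: SilvermanAEC2009, III.4 (End(E)) and Remark 4.3] -/
theorem hasRationalCM_of_isogeny {V : WeierstrassCurve K} (φ : Isogeny V V)
    (hφ : ∀ n : ℤ, ∃ P : V.geomPoints, φ P ≠ n • P) : V.HasRationalCM := by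
  refine ⟨φ.toAddMonoidHom, φ.toAddMonoidHom_mem_endRing, fun n hn ↦ ?_⟩
  obtain ⟨P, hP⟩ := hφ n
  apply hP
  have h1 := DFunLike.congr_fun hn P
  rw [AddMonoid.End.intCast_apply] at h1
  exact h1

/-- **`End_K(E) ⊋ ℤ` iff some `K`-isogeny `E → E` is no `[n]`** (`E` elliptic).
[cite: SilvermanAEC2009, III.4 (End(E)) and Remark 4.3] -/
theorem hasRationalCM_iff_exists_isogeny {V : WeierstrassCurve K} [V.IsElliptic] :
    V.HasRationalCM ↔ ∃ φ : Isogeny V V, ∀ n : ℤ, ∃ P : V.geomPoints, φ P ≠ n • P :=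
  ⟨HasRationalCM.exists_isogeny, fun ⟨φ, hφ⟩ ↦ hasRationalCM_of_isogeny φ hφ⟩

/-- **`End_K(E) ⊋ ℤ` is invariant under `K`-isomorphisms, `E ↦ C • E`.** Conjugate a
`K`-isogeny `φ ∉ ℤ` by the isomorphism `ι : E ≅ C • E` of the change of variables and its inverse
`ι'` (`VariableChange.toIsogeny`, transported along `C⁻¹ • C • E = E`;
`VariableChange.cast_toIsogeny_inv_toIsogeny`: `ι' ∘ ι = id`): `ι ∘ φ ∘ ι'` is a `K`-isogeny of
`C • E`, and `ι φ ι' = [n]` would give, evaluating at `ι Q`, `ι(φ Q) = n ι(Q) = ι(nQ)`, `φ Q = nQ`.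
Silverman, *AEC*, III.3.1(b) (isomorphic Weierstrass models), III.4.
[cite: SilvermanAEC2009, III.3.1(b) and III.4] -/
theorem HasRationalCM.smul {V : WeierstrassCurve K} [V.IsElliptic] (h : V.HasRationalCM)
    (C : VariableChange K) : (C • V).HasRationalCM := by
  obtain ⟨φ, hφ⟩ := h.exists_isogeny
  have hinv := VariableChange.cast_toIsogeny_inv_toIsogeny V C
  refine hasRationalCM_of_isogeny
    (((VariableChange.toIsogeny V C).comp φ).comp
      ((congrArg (Isogeny (C • V)) (inv_smul_smul C V)).mp (VariableChange.toIsogeny (C • V) C⁻¹)))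
    fun n ↦ ?_
  obtain ⟨Q, hQ⟩ := hφ n
  refine ⟨VariableChange.toIsogeny V C Q, fun h1 ↦ hQ ?_⟩
  rw [Isogeny.comp_apply, Isogeny.comp_apply, hinv Q, ← map_zsmul] at h1
  exact VariableChange.toIsogeny_injective V C h1

/-- **… and conversely**: if `C • E` has `End_K ⊋ ℤ` then so does `E = C⁻¹ • (C • E)`.
[cite: SilvermanAEC2009, III.3.1(b) and III.4] -/
theorem HasRationalCM.of_smul {V : WeierstrassCurve K} [V.IsElliptic] {C : VariableChange K}
    (h : (C • V).HasRationalCM) : V.HasRationalCM := by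
  have h' := h.smul C⁻¹
  rwa [inv_smul_smul] at h'

/-- `End_K(C • E) ⊋ ℤ ↔ End_K(E) ⊋ ℤ`. [cite: SilvermanAEC2009, III.3.1(b) and III.4] -/
theorem hasRationalCM_smul_iff {V : WeierstrassCurve K} [V.IsElliptic] (C : VariableChange K) :
    (C • V).HasRationalCM ↔ V.HasRationalCM :=
  ⟨HasRationalCM.of_smul, fun h ↦ h.smul C⟩

/-- `End_K ⊋ ℤ` passes along an equality of models `C • V = V'`.
[cite: SilvermanAEC2009, III.3.1(b) and III.4] -/
theorem HasRationalCM.of_smul_eq {V V' : WeierstrassCurve K} [V.IsElliptic] {C : VariableChange K}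
    (hC : C • V = V') (h : V.HasRationalCM) : V'.HasRationalCM :=
  hC ▸ h.smul C

/-- **Quadratic twists of a curve with `K`-rational CM have `K`-rational CM — models with
`a₁ = a₃ = 0`** (`2 ≠ 0` in `K`, `d ∈ K^×`). For a `K`-isogeny `φ : E → E`, `φ ∉ ℤ`, the twisted
isogeny `φ^{(d)} = ι⁻¹ ∘ φ ∘ ι : E^{(d)} → E^{(d)}` (`Isogeny.quadraticTwist`; `ι : E^{(d)}(K̄) ≃ E(K̄)`
the `K(√d)`-isomorphism `untwistEquiv`) is defined over `K` (Cremona, *Algorithms*, §3.9: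
"Twisting commutes with isogenies") and is no `[n]`: `ι⁻¹ φ ι = [n]` gives, at `ι⁻¹ Q`,
`φ Q = ι(n ι⁻¹ Q) = nQ`. [cite: CremonaAlgorithms1997, §3.9 (p. 87)]
[cite: SilvermanATAEC1994, II §2 Thm. 2.2 (b)] -/
theorem HasRationalCM.quadraticTwist_of_isCharNeTwoNF [NeZero (2 : K)] {V : WeierstrassCurve K}
    [V.IsCharNeTwoNF] [V.IsElliptic] (h : V.HasRationalCM) {d : K} (hd : d ≠ 0) :
    (V.quadraticTwist d).HasRationalCM := by
  obtain ⟨φ, hφ⟩ := h.exists_isogeny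
  refine hasRationalCM_of_isogeny (φ.quadraticTwist hd) fun n ↦ ?_
  obtain ⟨Q, hQ⟩ := hφ n
  refine ⟨(untwistEquiv V hd).symm Q, fun h1 ↦ hQ ?_⟩
  rw [Isogeny.quadraticTwist_apply, AddEquiv.apply_symm_apply, ← map_zsmul] at h1
  exact (untwistEquiv V hd).symm.injective h1

/-- **Quadratic twists of a curve with `K`-rational CM have `K`-rational CM** (`char K = 0`, `E`
elliptic, `d ∈ K^×`): `End_K(E) ⊋ ℤ ⟹ End_K(E^{(d)}) ⊋ ℤ` for the tree's model
`WeierstrassCurve.quadraticTwist`. Reduction to a model `E₀ = C • E` with `a₁ = a₃ = 0`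
(`toCharNeTwoNF`; `HasRationalCM.smul`), twist there (`quadraticTwist_of_isCharNeTwoNF`), and
`E₀^{(d)} = C' • E^{(d)}` (`quadraticTwist_smul`; `HasRationalCM.of_smul`). In Burungale–Tian's
setting (`K` imaginary quadratic, `E/K` with CM by an order of `K`) this is the statement that
every twist `E^{(t)}` is again "an elliptic curve defined over `K` with CM by an order of `K`",
used in "Proof of Proposition 1.3" to apply Thm. 1.1 to `E^{(t)}` (Silverman, *Advanced Topics*,
II Thm. 2.2 (b): all endomorphisms are defined over `K`). [cite: BurungaleTian2026, §3.2.2 "Proof of Proposition 1.3" (p. 7)]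
[cite: SilvermanATAEC1994, II §2 Thm. 2.2 (b)] [cite: CremonaAlgorithms1997, §3.9 (p. 87)] -/
theorem HasRationalCM.quadraticTwist [CharZero K] {V : WeierstrassCurve K} [V.IsElliptic]
    (h : V.HasRationalCM) {d : K} (hd : d ≠ 0) : (V.quadraticTwist d).HasRationalCM := by
  haveI : NeZero (2 : K) := ⟨two_ne_zero⟩
  letI : Invertible (2 : K) := invertibleOfNonzero two_ne_zero
  have h₀ : (V.toCharNeTwoNF • V).HasRationalCM := h.smul V.toCharNeTwoNF
  have h₁ : ((V.toCharNeTwoNF • V).quadraticTwist d).HasRationalCM :=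
    h₀.quadraticTwist_of_isCharNeTwoNF hd
  rw [quadraticTwist_smul] at h₁
  haveI : (V.quadraticTwist d).IsElliptic := V.isElliptic_quadraticTwist hd
  exact HasRationalCM.of_smul h₁

end WeierstrassCurve

/-! ## (b) Finitely many square classes of bounded height; monotonicity of "at least `δ`" -/

namespace Literature.NumberTheory.EllipticCurves

open WeierstrassCurve IsDedekindDomain NumberField

section Finiteness

variable {K : Type u} [Field K] [NumberField K]

/-- The primes of `K` at which a given `x ∈ K^×` is not a unit form a finite set: writing `x = a/b`
with `a, b ∈ 𝓞_K ∖ {0}`, such a prime divides `(a)` or `(b)` (Mathlib `Ideal.finite_factors`).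
[folklore] -/
private theorem finite_setOf_valuation_units_ne_one (x : Kˣ) :
    {v : HeightOneSpectrum (𝓞 K) | v.valuation K (x : K) ≠ 1}.Finite := by
  obtain ⟨a, b, hb, hab⟩ := IsFractionRing.div_surjective (A := 𝓞 K) (x : K)
  have hb0 : b ≠ 0 := nonZeroDivisors.ne_zero hb
  have ha0 : a ≠ 0 := by
    rintro rfl
    apply x.ne_zero
    rw [← hab, map_zero, zero_div]
  have hfa : {v : HeightOneSpectrum (𝓞 K) | v.asIdeal ∣ Ideal.span {a}}.Finite :=
    Ideal.finite_factors (by simpa using ha0)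
  have hfb : {v : HeightOneSpectrum (𝓞 K) | v.asIdeal ∣ Ideal.span {b}}.Finite :=
    Ideal.finite_factors (by simpa using hb0)
  refine (hfa.union hfb).subset fun v hv ↦ ?_
  simp only [Set.mem_setOf_eq, Set.mem_union] at hv ⊢
  by_contra hnot
  obtain ⟨hna, hnb⟩ := not_or.1 hnot
  have ha1 : v.valuation K (algebraMap (𝓞 K) K a) = 1 :=
    le_antisymm (v.valuation_le_one a)
      (not_lt.1 fun hlt ↦ hna ((v.valuation_lt_one_iff_dvd a).1 hlt))
  have hb1 : v.valuation K (algebraMap (𝓞 K) K b) = 1 :=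
    le_antisymm (v.valuation_le_one b)
      (not_lt.1 fun hlt ↦ hnb ((v.valuation_lt_one_iff_dvd b).1 hlt))
  apply hv
  rw [← hab, map_div₀, ha1, hb1, div_one]

/-- At a prime where `x ∈ K^×` is a unit, the valuation of the square class of `x` is even
(`valuationOfNeZeroMod 2 = 1`). [folklore] -/
private theorem valuationOfNeZeroMod_two_mk_eq_one_of_valuation_eq_one (v : HeightOneSpectrum (𝓞 K))
    (x : Kˣ) (hx : v.valuation K (x : K) = 1) :
    v.valuationOfNeZeroMod 2 (QuotientGroup.mk x : SquareClass K) = 1 := by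
  rw [HeightOneSpectrum.valuationOfNeZeroMod_mk_eq_one_iff]
  have h1 : v.valuationOfNeZero (K := K) x = 1 := by
    have h := v.valuationOfNeZero_eq (K := K) x
    rw [hx] at h
    exact_mod_cast h
  rw [h1]
  exact ⟨0, by simp⟩

/-- **The height is a finite product**: for every square class `t`, only finitely many primes
contribute a factor `N𝔭 ≠ 1` to `H(t) = ∏_{𝔭 : v_𝔭(t) odd} N𝔭` (those dividing a representative).
Bhargava–Klagsbrun–Lemke Oliver–Shnidman 2019, §2 (definition of `H(s)`).
[cite: BhargavaKlagsbrunLemkeOliverShnidman2019, §2 (definition of H(s))] -/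
theorem hasFiniteMulSupport_squareClassHeight (t : SquareClass K) :
    (fun v : HeightOneSpectrum (𝓞 K) ↦
      if v.valuationOfNeZeroMod 2 t = 1 then 1 else Ideal.absNorm v.asIdeal).HasFiniteMulSupport := by
  obtain ⟨x, rfl⟩ := QuotientGroup.mk_surjective t
  refine (finite_setOf_valuation_units_ne_one x).subset fun v hv ↦ ?_
  simp only [Function.mem_mulSupport, ne_eq, ite_eq_left_iff, not_forall, exists_prop] at hv
  intro h1
  exact hv.1 (valuationOfNeZeroMod_two_mk_eq_one_of_valuation_eq_one v x h1)

/-- **A prime of odd valuation divides the height**: if `v_𝔭(t)` is odd then `N𝔭 ≤ H(t)` (indeed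
`N𝔭 ∣ H(t)`, a finite product of norms of nonzero ideals). BKLOS 2019, §2.
[cite: BhargavaKlagsbrunLemkeOliverShnidman2019, §2 (definition of H(s))] -/
theorem absNorm_le_squareClassHeight_of_ne_one (t : SquareClass K) (v : HeightOneSpectrum (𝓞 K))
    (hv : v.valuationOfNeZeroMod 2 t ≠ 1) : Ideal.absNorm v.asIdeal ≤ squareClassHeight t := by
  have hdvd : Ideal.absNorm v.asIdeal ∣ squareClassHeight t := by
    have h := finprod_mem_dvd v (hasFiniteMulSupport_squareClassHeight t)
    simp only [hv, if_false] at h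
    exact h
  refine Nat.le_of_dvd (Nat.pos_of_ne_zero fun h0 ↦ ?_) hdvd
  -- `H(t) ≠ 0`: a finite product of norms of nonzero ideals
  unfold squareClassHeight at h0
  rw [finprod_eq_prod _ (hasFiniteMulSupport_squareClassHeight t), Finset.prod_eq_zero_iff] at h0
  obtain ⟨w, -, hw⟩ := h0
  by_cases hw1 : w.valuationOfNeZeroMod 2 t = 1
  · rw [if_pos hw1] at hw
    exact one_ne_zero hw
  · rw [if_neg hw1] at hw
    exact w.ne_bot (Ideal.absNorm_eq_zero_iff.1 hw)

/-- **There are only finitely many square classes of height `< X`** (Bhargava–Klagsbrun–Lemke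
Oliver–Shnidman 2019, §2: "`Σ(X) := {s ∈ Σ : H(s) < X}`" is a finite set; for `F = ℚ` "the
squareclasses of all squarefree integers of absolute value less than `X`"). A class of height
`< X` has even valuation at every prime `𝔭` with `N𝔭 ≥ X` (`absNorm_le_squareClassHeight_of_ne_one`),
so lies in the Selmer group `K(S_X, 2)`, `S_X = {𝔭 : N𝔭 < X}`; `S_X` is finite (Mathlib
`Ideal.finite_setOf_absNorm_le`) and `K(S, 2)` is finite for finite `S` (tree
`NumberField.finite_selmerGroup`: Dirichlet's unit theorem and finiteness of the class group).
[cite: BhargavaKlagsbrunLemkeOliverShnidman2019, §2 (the sets Σ(X))] -/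
theorem finite_setOf_squareClassHeight_lt (X : ℕ) :
    {t : SquareClass K | squareClassHeight t < X}.Finite := by
  set S : Set (HeightOneSpectrum (𝓞 K)) := {v | Ideal.absNorm v.asIdeal < X} with hSdef
  have hS : S.Finite := by
    have hinj : Set.InjOn (fun v : HeightOneSpectrum (𝓞 K) ↦ v.asIdeal)
        ((fun v : HeightOneSpectrum (𝓞 K) ↦ v.asIdeal) ⁻¹' {I : Ideal (𝓞 K) | Ideal.absNorm I ≤ X}) :=
      fun v _ w _ h ↦ HeightOneSpectrum.ext h
    refine ((Ideal.finite_setOf_absNorm_le (S := 𝓞 K) X).preimage hinj).subset fun v hv ↦ ?_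
    simp only [Set.mem_preimage, Set.mem_setOf_eq]
    exact le_of_lt hv
  haveI : Finite (selmerGroup (R := 𝓞 K) (K := K) (S := S) (n := 2)) :=
    NumberField.finite_selmerGroup K hS two_pos
  refine (Set.toFinite (selmerGroup (R := 𝓞 K) (K := K) (S := S) (n := 2) :
    Set (SquareClass K))).subset fun t ht ↦ ?_
  simp only [Set.mem_setOf_eq] at ht
  show t ∈ selmerGroup
  intro v hv
  by_contra hne
  exact hv ((absNorm_le_squareClassHeight_of_ne_one t v hne).trans_lt ht)

/-- The counting sets of `SquareClassProportionGe` are finite. [cite: BhargavaKlagsbrunLemkeOliverShnidman2019, §2 (the sets Σ(X))] -/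
theorem finite_setOf_squareClassHeight_lt_and (X : ℕ) (P : SquareClass K → Prop) :
    {t : SquareClass K | squareClassHeight t < X ∧ P t}.Finite :=
  (finite_setOf_squareClassHeight_lt X).subset fun _ ht ↦ ht.1

/-- **Monotonicity of "for at least `δ` of `t ∈ K^×/(K^×)²`"**: if `P(t) ⟹ Q(t)` for every class
`t`, then "at least `δ` of `t` satisfy `P`" implies "at least `δ` of `t` satisfy `Q`" — the
numerator only grows (`finite_setOf_squareClassHeight_lt`: the counts are honest), and `liminf` is
monotone on ratios in `[0, 1]`. This is the form in which Burungale–Tian pass from Thm. 3.5 to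
Prop. 1.3. [cite: BurungaleTian2026, §3.2.2 "Proof of Proposition 1.3" (p. 7)] -/
theorem SquareClassProportionGe.mono {P Q : SquareClass K → Prop} (hPQ : ∀ t, P t → Q t) {δ : ℝ}
    (h : SquareClassProportionGe P δ) : SquareClassProportionGe Q δ := by
  unfold SquareClassProportionGe at h ⊢
  refine le_trans h (Filter.liminf_le_liminf (Filter.Eventually.of_forall fun X ↦ ?_) ?_ ?_)
  · refine div_le_div_of_nonneg_right ?_ (Nat.cast_nonneg _)
    have hsub : {t : SquareClass K | squareClassHeight t < X ∧ P t} ⊆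
        {t : SquareClass K | squareClassHeight t < X ∧ Q t} := fun t ht ↦ ⟨ht.1, hPQ t ht.2⟩
    exact_mod_cast Nat.card_mono (finite_setOf_squareClassHeight_lt_and X Q) hsub
  · exact Filter.isBoundedUnder_of ⟨0, fun X ↦ div_nonneg (Nat.cast_nonneg _) (Nat.cast_nonneg _)⟩
  · refine Filter.IsBoundedUnder.isCoboundedUnder_ge (Filter.isBoundedUnder_of ⟨1, fun X ↦ ?_⟩)
    refine div_le_one_of_le₀ ?_ (Nat.cast_nonneg _)
    have hsub : {t : SquareClass K | squareClassHeight t < X ∧ Q t} ⊆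
        {t : SquareClass K | squareClassHeight t < X} := fun t ht ↦ ht.1
    exact_mod_cast Nat.card_mono (finite_setOf_squareClassHeight_lt X) hsub

end Finiteness

/-! ## The printed proof of Proposition 1.3 -/

/-- **Thm. 1.1 at a prime `p` transports "corank `Sel_{p^∞} = 0` for at least `δ` of the twists"
to "analytic rank `0` for at least `δ` of the twists"** (`K` imaginary quadratic, `E/K` with
`End_K(E) ⊋ ℤ`): each twist `E^{(s)}`, `s ∈ K^×`, is again an elliptic curve over `K` with
`End_K ⊋ ℤ` (`HasRationalCM.quadraticTwist`), so Thm. 1.1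
(`burungaleTian_analyticRank_eq_zero_of_selmerCorank_eq_zero_of_hasRationalCM`) applies to it,
and "at least `δ`" is monotone (`SquareClassProportionGe.mono`). [cite: BurungaleTian2026, Thm. 1.1 (p. 1) and §3.2.2 "Proof of Proposition 1.3" (p. 7)] -/
theorem squareClassProportionGe_analyticRank_of_selmerCorank
    (h11 : burungaleTian_analyticRank_eq_zero_of_selmerCorank_eq_zero_of_hasRationalCM)
    {K : Type} [Field K] [NumberField K] (hK : IsImaginaryQuadratic K) (V : WeierstrassCurve K)
    [V.IsElliptic] (hCM : V.HasRationalCM) (p : ℕ) [Fact p.Prime] {δ : ℝ}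
    (h : SquareClassProportionGe
      (TwistClassSatisfies V fun E : WeierstrassCurve K ↦ E.selmerCorank p = 0) δ) :
    SquareClassProportionGe (TwistClassSatisfies V fun E : WeierstrassCurve K ↦ E.analyticRank = 0) δ := by
  refine SquareClassProportionGe.mono (fun t ht s hs ↦ ?_) h
  haveI : (V.quadraticTwist (s : K)).IsElliptic := V.isElliptic_quadraticTwist s.ne_zero
  exact h11 K hK (V.quadraticTwist (s : K)) (hCM.quadraticTwist s.ne_zero) p (ht s hs)

/-- **Burungale–Tian 2026, "Proof of Proposition 1.3" (arXiv p. 7), in the kernel**: "This is a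
consequence of Theorem 3.5 and the `3`-converse Theorem 1.1." Theorem 3.5
(`burungaleTian_thm35_selmerCorank_three_twists`: for at least `50%` of `t`,
`corank_{ℤ₃} Sel_{3^∞}(E^{(t)}/K) = 0`) and Theorem 1.1
(`burungaleTian_analyticRank_eq_zero_of_selmerCorank_eq_zero_of_hasRationalCM`, at `p = 3`, applied
to each `E^{(t)}` — again a CM curve over `K` with `End_K ⊋ ℤ`, `HasRationalCM.quadraticTwist`)
give Proposition 1.3 (`burungaleTian_prop13_analyticRank_twists`: for at least `50%` of `t`,
`ord_{s=1} L(s, E^{(t)}/K) = 0`). [cite: BurungaleTian2026, §3.2.2 "Proof of Proposition 1.3" (p. 7)] -/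
theorem burungaleTian_prop13_of_thm35_of_thm11
    (h35 : burungaleTian_thm35_selmerCorank_three_twists)
    (h11 : burungaleTian_analyticRank_eq_zero_of_selmerCorank_eq_zero_of_hasRationalCM) :
    burungaleTian_prop13_analyticRank_twists := by
  intro K _ _ hK h3 V _ hCM
  haveI : Fact (Nat.Prime 3) := ⟨Nat.prime_three⟩
  exact squareClassProportionGe_analyticRank_of_selmerCorank h11 hK V hCM 3 (h35 K hK h3 V hCM)

end Literature.NumberTheory.EllipticCurves

end
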